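import Literature.Probability.Percolation.SelfRefinementMeasure
import Literature.Probability.Percolation.KohlerSchindlerTassionRSW
import Summits.CriticalPhenomena.CardyFormulaZ2.Theorems.CardySelfRefinementCriticalPathRSWStubCone3Sections
import Summits.CriticalPhenomena.CardyFormulaZ2.Theorems.CardySelfRefinementCriticalPathRSWStubCone3LocalC

/-!
# Stub `stub_cone3` of line `finite-size-envelope` (crux `CriticalPathRSW`), part 12:
the probability of an atom is charged to pivotal interior labels (interior density `c ≥ 1/10`)

Support file for item `stmt-CriticalPhenomena-10267` (stub `stub_cone3`).  For the tuple `(b, d)`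
inside the box `[-3n, 3n] × [-9n, 9n]` (not inside a side), the event that some single sub-edge
is an **atom** — with the tuple closed the sides are not joined, with that sub-edge alone opened
they are — has probability at most `240000 · Σ_{g ∈ Π} P(g pivotal)`, where `Π` is the explicit
list of the eighteen interior labels next to the tuple used by the walks of parts 7–8 and
`c ≥ 1/10` bounds the cost of opening at most three of them (`Cone3.real_atom_le`).  The bound is
uniform in the tying parameter `ρ ∈ [0, 1]`.

References: Aizenman–Grimmett 1991 §3; Grimmett 1999 §2.4.
-/

noncomputable section

namespace Summit.CriticalPhenomena.CardyFormulaZ2.Cruxes.CriticalPathRSW.FiniteSizeEnvelope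

open Set MeasureTheory
open Literature.Probability.LatticeModels Literature.Probability.Percolation

namespace Cone3

variable {n : ℕ} {ρ c : ℝ} {b : Site 2} {d d' : Fin 2}

set_option quotPrecheck false

/-- The local frame of the tuple `(b, d)`: `pt⟪α, β⟫ = 3b + α e_d + β e_{d'}`. -/
local notation "pt⟪" α ", " β "⟫" =>
  ((3 : ℤ) • b + (α : ℤ) • (Pi.single d (1 : ℤ) : Site 2) + (β : ℤ) • (Pi.single d' (1 : ℤ) : Site 2))

/-- The open labels of a coin configuration. -/
local notation "Op⟪" S "⟫" => {e : Site 2 × Fin 2 | RefinementOpen 3 S e}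

/-- Crossing of the box by a label configuration. -/
local notation "Cr⟪" V "⟫" => (edgeConfig V ∈ KST2023.crossing (3 * n) (3 * (3 * n)))

/-- The override event: close `C`, open `A`, and ask for a left-right crossing of the box. -/
local notation "Z⟪" C ", " A "⟫" =>
  {S : Set (Site 2 × Fin 2 × Fin 3) |
    edgeConfig ((Op⟪S⟫ \ C) ∪ A) ∈ KST2023.crossing (3 * n) (3 * (3 * n))}

/-- The three sub-edges of the tuple. -/
local notation "Tl" =>
  ({(pt⟪0, 0⟫, d), (pt⟪1, 0⟫, d), (pt⟪2, 0⟫, d)} : Set (Site 2 × Fin 2))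

/-- The box. -/
local notation "Bx" => (KST2023.box (3 * n) (3 * (3 * n)))

/-- Its left side. -/
local notation "Lx" => {x : Site 2 | x ∈ KST2023.box (3 * n) (3 * (3 * n)) ∧ x 0 = -((3 * n : ℕ) : ℤ)}

/-- Its right side. -/
local notation "Rx" => {x : Site 2 | x ∈ KST2023.box (3 * n) (3 * (3 * n)) ∧ x 0 = ((3 * n : ℕ) : ℤ)}

/-- Pivotality of the own coin of the interior label `g`. -/
local notation "Piv⟪" g "⟫" =>
  ({S : Set (Site 2 × Fin 2 × Fin 3) |
      edgeConfig ((Op⟪S⟫ \ {g}) ∪ {g}) ∈ KST2023.crossing (3 * n) (3 * (3 * n))} \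
    {S : Set (Site 2 × Fin 2 × Fin 3) |
      edgeConfig ((Op⟪S⟫ \ {g}) ∪ ∅) ∈ KST2023.crossing (3 * n) (3 * (3 * n))})

/-- The walk event: tuple closed, `O` open, `g` pivotal. -/
local notation "Wev⟪" O ", " g "⟫" => (Z⟪{g} ∪ Tl, {g} ∪ ↑O⟫ \ Z⟪{g} ∪ Tl, ∅ ∪ ↑O⟫)

/-- The eighteen interior labels next to the tuple used by the walks. -/
local notation "Πf" =>
  ({(pt⟪0, 1⟫, d), (pt⟪1, 0⟫, d'), (pt⟪-1, 0⟫, d'), (pt⟪-1, 1⟫, d), (pt⟪2, 1⟫, d), (pt⟪2, 0⟫, d'),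
    (pt⟪4, 0⟫, d'), (pt⟪3, 1⟫, d), (pt⟪1, 1⟫, d),
    (pt⟪0, -1⟫, d), (pt⟪1, -1⟫, d'), (pt⟪-1, -1⟫, d'), (pt⟪-1, -1⟫, d), (pt⟪2, -1⟫, d), (pt⟪2, -1⟫, d'),
    (pt⟪4, -1⟫, d'), (pt⟪3, -1⟫, d), (pt⟪1, -1⟫, d)} : Finset (Site 2 × Fin 2))

/-- The coin law. -/
local notation "P" => (prodBernoulli (refinementParam 3 ρ c))

/-! ### From a surgery conclusion to a walk event -/

/-- A surgery conclusion `¬ Cr⟪W₁⟫ ∧ Cr⟪W₂⟫` places the configuration in the walk event of `(O, g)`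
as soon as `(Op⟪S⟫ \ T) ∪ O ⊆ W₁` and `W₂ ⊆ (Op⟪S⟫ \ T) ∪ O ∪ {g}`. -/
theorem mem_walkEvent {S : Set (Site 2 × Fin 2 × Fin 3)} {O : Finset (Site 2 × Fin 2)} {g : Site 2 × Fin 2}
    {W₁ W₂ : Set (Site 2 × Fin 2)} (h1 : ¬ Cr⟪W₁⟫) (h2 : Cr⟪W₂⟫) (hW₁ : (Op⟪S⟫ \ Tl) ∪ ↑O ⊆ W₁)
    (hW₂ : W₂ ⊆ (Op⟪S⟫ \ Tl) ∪ ↑O ∪ {g}) : S ∈ Wev⟪O, g⟫ := by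
  apply walk_event_subset
  exact ⟨fun h => h1 (crossing_mono hW₁ h), crossing_mono hW₂ h2⟩

/-! ### Reassociating the surgery conclusions -/

section Reassoc
variable {V : Set (Site 2 × Fin 2)} {x y z w : Site 2 × Fin 2}

/-- Shape `(∅, x)`, lower set. -/
theorem sub0 : V ∪ ↑(∅ : Finset (Site 2 × Fin 2)) ⊆ V := by
  rw [Finset.coe_empty, Set.union_empty]

/-- Shape `(∅, x)`, upper set. -/
theorem sub0' : V ∪ {x} ⊆ V ∪ ↑(∅ : Finset (Site 2 × Fin 2)) ∪ {x} := by
  rw [Finset.coe_empty, Set.union_empty]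

/-- Shape `({x}, y)`, lower set. -/
theorem sub1 : V ∪ ↑({x} : Finset (Site 2 × Fin 2)) ⊆ V ∪ {x} := by
  rw [Finset.coe_singleton]

/-- Shape `({x}, y)`, upper set. -/
theorem sub1' : V ∪ {x} ∪ {y} ⊆ V ∪ ↑({x} : Finset (Site 2 × Fin 2)) ∪ {y} := by
  rw [Finset.coe_singleton]

/-- Shape `({x, y}, z)`, lower set. -/
theorem sub2 : V ∪ ↑({x, y} : Finset (Site 2 × Fin 2)) ⊆ V ∪ {x} ∪ {y} := by
  rw [Finset.coe_insert, Finset.coe_singleton]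
  rintro e (he | he | he)
  · exact Or.inl (Or.inl he)
  · exact Or.inl (Or.inr he)
  · exact Or.inr he

/-- Shape `({x, y}, z)`, upper set. -/
theorem sub2' : V ∪ {x} ∪ {y} ∪ {z} ⊆ V ∪ ↑({x, y} : Finset (Site 2 × Fin 2)) ∪ {z} := by
  rw [Finset.coe_insert, Finset.coe_singleton]
  rintro e (((he | he) | he) | he)
  · exact Or.inl (Or.inl he)
  · exact Or.inl (Or.inr (Or.inl he))
  · exact Or.inl (Or.inr (Or.inr he))
  · exact Or.inr he

/-- Shape `({x, y, z}, w)`, lower set. -/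
theorem sub3 : V ∪ ↑({x, y, z} : Finset (Site 2 × Fin 2)) ⊆ V ∪ {x} ∪ {y} ∪ {z} := by
  rw [Finset.coe_insert, Finset.coe_insert, Finset.coe_singleton]
  rintro e (he | he | he | he)
  · exact Or.inl (Or.inl (Or.inl he))
  · exact Or.inl (Or.inl (Or.inr he))
  · exact Or.inl (Or.inr he)
  · exact Or.inr he

/-- Shape `({x, y, z}, w)`, upper set. -/
theorem sub3' : V ∪ {x} ∪ {y} ∪ {z} ∪ {w} ⊆ V ∪ ↑({x, y, z} : Finset (Site 2 × Fin 2)) ∪ {w} := by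
  rw [Finset.coe_insert, Finset.coe_insert, Finset.coe_singleton]
  rintro e ((((he | he) | he) | he) | he)
  · exact Or.inl (Or.inl he)
  · exact Or.inl (Or.inr (Or.inl he))
  · exact Or.inl (Or.inr (Or.inr (Or.inl he)))
  · exact Or.inl (Or.inr (Or.inr (Or.inr he)))
  · exact Or.inr he

end Reassoc

/-- The cost of a walk event: `P(Wev⟪O, g⟫) ≤ 8000 · P(g pivotal)` for `|O| ≤ 3`, `c ≥ 1/10`. -/
theorem real_walkEvent_le (hd : d' ≠ d) (hρ0 : 0 ≤ ρ) (hρ1 : ρ ≤ 1) (hc : 1 / 10 ≤ c) (hc1 : c ≤ 1)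
    {O : Finset (Site 2 × Fin 2)} (hO : ∀ ℓ ∈ O, ¬ IsAxialEdge 3 ℓ) (hO3 : O.card ≤ 3)
    {g : Site 2 × Fin 2} (hgO : g ∉ O) :
    (P).real Wev⟪O, g⟫ ≤ 8000 * (P).real Piv⟪g⟫ := by
  have hc0 : (0 : ℝ) ≤ c := by linarith
  have h := walk_event_bound (n := n) (b := b) hd hρ0 hρ1 hc0 hc1 hO hgO
  have hcpow : (1 / 1000 : ℝ) ≤ c ^ O.card := by
    calc (1 / 1000 : ℝ) = (1 / 10) ^ 3 := by norm_num
      _ ≤ (1 / 10) ^ O.card := pow_le_pow_of_le_one (by norm_num) (by norm_num) hO3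
      _ ≤ c ^ O.card := pow_le_pow_left₀ (by norm_num) hc _
  have hE0 : 0 ≤ (P).real Wev⟪O, g⟫ := measureReal_nonneg
  nlinarith [mul_le_mul_of_nonneg_right hcpow hE0]

/-! ### Interior labels and their distinctness -/

/-- Labels of direction `d` based on a row `β` with `3 ∤ β` are interior. -/
theorem not_axial_d (hd : d' ≠ d) (α : ℤ) {β : ℤ} (hβ : ¬ (3 : ℤ) ∣ β) : ¬ IsAxialEdge 3 (pt⟪α, β⟫, d) := by
  rw [isAxialEdge_pt_d hd]; exact hβ

/-- Labels of direction `d'` based on a column `α` with `3 ∤ α` are interior. -/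
theorem not_axial_d' (hd : d' ≠ d) {α : ℤ} (β : ℤ) (hα : ¬ (3 : ℤ) ∣ α) : ¬ IsAxialEdge 3 (pt⟪α, β⟫, d') := by
  rw [isAxialEdge_pt_d' hd]; exact hα

/-- Two labels of different directions differ. -/
theorem lab_ne_of_dir (hd : d' ≠ d) (α β α' β' : ℤ) : (pt⟪α, β⟫, d) ≠ (pt⟪α', β'⟫, d') := by
  intro h; exact hd (Prod.ext_iff.1 h).2.symm

/-- Two labels of the same direction are equal iff their offsets are. -/
theorem lab_eq_iff (hd : d' ≠ d) (α β α' β' : ℤ) (d₀ : Fin 2) :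
    (pt⟪α, β⟫, d₀) = (pt⟪α', β'⟫, d₀) ↔ α = α' ∧ β = β' := by
  rw [Prod.ext_iff]
  simp only [pt_eq_iff hd, and_true]

/-! ### The three atoms -/

/-- A single walk-event probability is at most `8000 · Σ_{g ∈ Π} P(g pivotal)` once `g ∈ Π`. -/
theorem real_walkEvent_le_sum (hd : d' ≠ d) (hρ0 : 0 ≤ ρ) (hρ1 : ρ ≤ 1) (hc : 1 / 10 ≤ c) (hc1 : c ≤ 1)
    {O : Finset (Site 2 × Fin 2)} (hO : ∀ ℓ ∈ O, ¬ IsAxialEdge 3 ℓ) (hO3 : O.card ≤ 3)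
    {g : Site 2 × Fin 2} (hgO : g ∉ O) (hg : g ∈ Πf) :
    (P).real Wev⟪O, g⟫ ≤ 8000 * ∑ g' ∈ Πf, (P).real Piv⟪g'⟫ := by
  refine (real_walkEvent_le hd hρ0 hρ1 hc hc1 hO hO3 hgO).trans ?_
  refine mul_le_mul_of_nonneg_left ?_ (by norm_num)
  exact Finset.single_le_sum (f := fun g' => (P).real Piv⟪g'⟫) (fun _ _ => measureReal_nonneg) hg

/-- **The atom at `u`.** -/
theorem real_atom_u_le (hd : d' ≠ d) (hρ0 : 0 ≤ ρ) (hρ1 : ρ ≤ 1) (hc : 1 / 10 ≤ c) (hc1 : c ≤ 1)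
    (hbox : ∀ j : ℤ, 0 ≤ j → j ≤ 3 → pt⟪j, 0⟫ ∈ Bx) (hrow : pt⟪0, 1⟫ ∈ Bx ∨ pt⟪0, -1⟫ ∈ Bx)
    (huR : pt⟪0, 0⟫ ∉ Rx)
    (huL : pt⟪0, 0⟫ ∈ Lx → ∀ s : ℤ, (s = 1 ∨ s = -1) → pt⟪0, s⟫ ∈ Bx → pt⟪0, s⟫ ∈ Lx) :
    (P).real (Z⟪Tl, {(pt⟪0, 0⟫, d)}⟫ \ Z⟪Tl, (∅ : Set (Site 2 × Fin 2))⟫) ≤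
      12 * 8000 * ∑ g' ∈ Πf, (P).real Piv⟪g'⟫ := by
  set PS := ∑ g' ∈ Πf, (P).real Piv⟪g'⟫ with hPS
  have hPS0 : 0 ≤ PS := Finset.sum_nonneg fun _ _ => measureReal_nonneg
  -- the twelve walk events, for the two rows
  have key : ∀ S ∈ Z⟪Tl, {(pt⟪0, 0⟫, d)}⟫ \ Z⟪Tl, (∅ : Set (Site 2 × Fin 2))⟫,
      ∃ t : ℤ, (t = 0 ∨ t = -1) ∧
        (S ∈ Wev⟪(∅ : Finset (Site 2 × Fin 2)), (pt⟪0, 2 * t + 1⟫, d)⟫ ∨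
          S ∈ Wev⟪({(pt⟪0, 2 * t + 1⟫, d)} : Finset (Site 2 × Fin 2)), (pt⟪1, t⟫, d')⟫ ∨
          S ∈ Wev⟪(∅ : Finset (Site 2 × Fin 2)), (pt⟪-1, t⟫, d')⟫ ∨
          S ∈ Wev⟪({(pt⟪-1, t⟫, d')} : Finset (Site 2 × Fin 2)), (pt⟪-1, 2 * t + 1⟫, d)⟫ ∨
          S ∈ Wev⟪({(pt⟪-1, t⟫, d'), (pt⟪-1, 2 * t + 1⟫, d)} : Finset (Site 2 × Fin 2)), (pt⟪0, 2 * t + 1⟫, d)⟫ ∨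
          S ∈ Wev⟪({(pt⟪-1, t⟫, d'), (pt⟪-1, 2 * t + 1⟫, d), (pt⟪0, 2 * t + 1⟫, d)} : Finset (Site 2 × Fin 2)),
            (pt⟪1, t⟫, d')⟫) := by
    rintro S ⟨hyes, hno⟩
    have hno' : ¬ Cr⟪Op⟪S⟫ \ Tl⟫ := by
      intro h; apply hno
      show Cr⟪(Op⟪S⟫ \ Tl) ∪ ∅⟫
      rw [Set.union_empty]; exact h
    have hT0 : (pt⟪0, 0⟫, d) ∉ Op⟪S⟫ \ Tl := fun h => h.2 (Or.inl rfl)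
    obtain ⟨t, s, ht, hs, hdisj⟩ := atom_u hd (V := Op⟪S⟫ \ Tl) hT0 hbox hrow huR huL hno' hyes
    subst hs
    refine ⟨t, ht, ?_⟩
    rcases hdisj with ⟨h1, h2⟩ | ⟨h1, h2⟩ | ⟨h1, h2⟩ | ⟨h1, h2⟩ | ⟨h1, h2⟩ | ⟨h1, h2⟩
    · exact Or.inl (mem_walkEvent h1 h2 sub0 sub0')
    · exact Or.inr (Or.inl (mem_walkEvent h1 h2 sub1 sub1'))
    · exact Or.inr (Or.inr (Or.inl (mem_walkEvent h1 h2 sub0 sub0')))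
    · exact Or.inr (Or.inr (Or.inr (Or.inl (mem_walkEvent h1 h2 sub1 sub1'))))
    · exact Or.inr (Or.inr (Or.inr (Or.inr (Or.inl (mem_walkEvent h1 h2 sub2 sub2')))))
    · exact Or.inr (Or.inr (Or.inr (Or.inr (Or.inr (mem_walkEvent h1 h2 sub3 sub3')))))
  -- each walk event costs at most `8000 PS`
  have bound : ∀ t : ℤ, (t = 0 ∨ t = -1) →
      (P).real (Wev⟪(∅ : Finset (Site 2 × Fin 2)), (pt⟪0, 2 * t + 1⟫, d)⟫) ≤ 8000 * PS ∧
      (P).real (Wev⟪({(pt⟪0, 2 * t + 1⟫, d)} : Finset (Site 2 × Fin 2)), (pt⟪1, t⟫, d')⟫) ≤ 8000 * PS ∧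
      (P).real (Wev⟪(∅ : Finset (Site 2 × Fin 2)), (pt⟪-1, t⟫, d')⟫) ≤ 8000 * PS ∧
      (P).real (Wev⟪({(pt⟪-1, t⟫, d')} : Finset (Site 2 × Fin 2)), (pt⟪-1, 2 * t + 1⟫, d)⟫) ≤ 8000 * PS ∧
      (P).real (Wev⟪({(pt⟪-1, t⟫, d'), (pt⟪-1, 2 * t + 1⟫, d)} : Finset (Site 2 × Fin 2)), (pt⟪0, 2 * t + 1⟫, d)⟫) ≤
        8000 * PS ∧
      (P).real (Wev⟪({(pt⟪-1, t⟫, d'), (pt⟪-1, 2 * t + 1⟫, d), (pt⟪0, 2 * t + 1⟫, d)} : Finset (Site 2 × Fin 2)),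
        (pt⟪1, t⟫, d')⟫) ≤ 8000 * PS := by
    intro t ht
    have h3 : ¬ (3 : ℤ) ∣ 2 * t + 1 := by rcases ht with rfl | rfl <;> decide
    have h1' : ¬ (3 : ℤ) ∣ 1 := by decide
    have hm1 : ¬ (3 : ℤ) ∣ -1 := by decide
    have ha := not_axial_d (b := b) hd 0 h3
    have hf := not_axial_d' (b := b) hd t h1'
    have hc' := not_axial_d' (b := b) hd t hm1
    have he := not_axial_d (b := b) hd (-1) h3
    have memPi : ∀ g : Site 2 × Fin 2,
        (g = (pt⟪0, 2 * t + 1⟫, d) ∨ g = (pt⟪1, t⟫, d') ∨ g = (pt⟪-1, t⟫, d') ∨ g = (pt⟪-1, 2 * t + 1⟫, d)) →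
        g ∈ Πf := by
      intro g hg
      rcases ht with rfl | rfl <;>
        simp only [show (2 : ℤ) * 0 + 1 = 1 by norm_num, show (2 : ℤ) * (-1) + 1 = -1 by norm_num] at hg <;>
        rcases hg with rfl | rfl | rfl | rfl <;>
        simp only [Finset.mem_insert, Finset.mem_singleton, true_or, or_true]
    have one : ∀ {O : Finset (Site 2 × Fin 2)} {g : Site 2 × Fin 2}, (∀ ℓ ∈ O, ¬ IsAxialEdge 3 ℓ) →
        O.card ≤ 3 → g ∉ O →
        (g = (pt⟪0, 2 * t + 1⟫, d) ∨ g = (pt⟪1, t⟫, d') ∨ g = (pt⟪-1, t⟫, d') ∨ g = (pt⟪-1, 2 * t + 1⟫, d)) →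
        (P).real Wev⟪O, g⟫ ≤ 8000 * PS :=
      fun hO hO3 hgO hg => real_walkEvent_le_sum hd hρ0 hρ1 hc hc1 hO hO3 hgO (memPi _ hg)
    -- distinctness of the four labels
    have hfa : (pt⟪1, t⟫, d') ≠ (pt⟪0, 2 * t + 1⟫, d) := (lab_ne_of_dir hd _ _ _ _).symm
    have hfc : (pt⟪1, t⟫, d') ≠ (pt⟪-1, t⟫, d') := by rw [Ne, lab_eq_iff hd]; omega
    have hfe : (pt⟪1, t⟫, d') ≠ (pt⟪-1, 2 * t + 1⟫, d) := (lab_ne_of_dir hd _ _ _ _).symm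
    have hec : (pt⟪-1, 2 * t + 1⟫, d) ≠ (pt⟪-1, t⟫, d') := lab_ne_of_dir hd _ _ _ _
    have hac : (pt⟪0, 2 * t + 1⟫, d) ≠ (pt⟪-1, t⟫, d') := lab_ne_of_dir hd _ _ _ _
    have hae : (pt⟪0, 2 * t + 1⟫, d) ≠ (pt⟪-1, 2 * t + 1⟫, d) := by rw [Ne, lab_eq_iff hd]; omega
    refine ⟨?_, ?_, ?_, ?_, ?_, ?_⟩
    · exact one (by simp) (by simp) (by simp) (Or.inl rfl)
    · refine one (fun ℓ hℓ => ?_) (by simp) (by rwa [Finset.mem_singleton]) (Or.inr (Or.inl rfl))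
      rw [Finset.mem_singleton] at hℓ; rw [hℓ]; exact ha
    · exact one (by simp) (by simp) (by simp) (Or.inr (Or.inr (Or.inl rfl)))
    · refine one (fun ℓ hℓ => ?_) (by simp) (by rwa [Finset.mem_singleton]) (Or.inr (Or.inr (Or.inr rfl)))
      rw [Finset.mem_singleton] at hℓ; rw [hℓ]; exact hc'
    · refine one (fun ℓ hℓ => ?_) (Finset.card_le_two.trans (by norm_num)) ?_ (Or.inl rfl)
      · rw [Finset.mem_insert, Finset.mem_singleton] at hℓ
        rcases hℓ with rfl | rfl
        · exact hc'
        · exact he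
      · rw [Finset.mem_insert, Finset.mem_singleton, not_or]; exact ⟨hac, hae⟩
    · refine one (fun ℓ hℓ => ?_) Finset.card_le_three ?_ (Or.inr (Or.inl rfl))
      · rw [Finset.mem_insert, Finset.mem_insert, Finset.mem_singleton] at hℓ
        rcases hℓ with rfl | rfl | rfl
        · exact hc'
        · exact he
        · exact ha
      · rw [Finset.mem_insert, Finset.mem_insert, Finset.mem_singleton, not_or, not_or]; exact ⟨hfc, hfe, hfa⟩
  -- union bound over the twelve events
  have hcover : Z⟪Tl, {(pt⟪0, 0⟫, d)}⟫ \ Z⟪Tl, (∅ : Set (Site 2 × Fin 2))⟫ ⊆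
      (⋃ t ∈ ({0, -1} : Finset ℤ),
        (Wev⟪(∅ : Finset (Site 2 × Fin 2)), (pt⟪0, 2 * t + 1⟫, d)⟫ ∪
          Wev⟪({(pt⟪0, 2 * t + 1⟫, d)} : Finset (Site 2 × Fin 2)), (pt⟪1, t⟫, d')⟫ ∪
          Wev⟪(∅ : Finset (Site 2 × Fin 2)), (pt⟪-1, t⟫, d')⟫ ∪
          Wev⟪({(pt⟪-1, t⟫, d')} : Finset (Site 2 × Fin 2)), (pt⟪-1, 2 * t + 1⟫, d)⟫ ∪
          Wev⟪({(pt⟪-1, t⟫, d'), (pt⟪-1, 2 * t + 1⟫, d)} : Finset (Site 2 × Fin 2)), (pt⟪0, 2 * t + 1⟫, d)⟫ ∪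
          Wev⟪({(pt⟪-1, t⟫, d'), (pt⟪-1, 2 * t + 1⟫, d), (pt⟪0, 2 * t + 1⟫, d)} : Finset (Site 2 × Fin 2)),
            (pt⟪1, t⟫, d')⟫)) := by
    intro S hS
    obtain ⟨t, ht, h⟩ := key S hS
    simp only [Set.mem_iUnion, Finset.mem_insert, Finset.mem_singleton, exists_prop]
    refine ⟨t, ht, ?_⟩
    rcases h with h | h | h | h | h | h
    · exact Or.inl (Or.inl (Or.inl (Or.inl (Or.inl h))))
    · exact Or.inl (Or.inl (Or.inl (Or.inl (Or.inr h))))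
    · exact Or.inl (Or.inl (Or.inl (Or.inr h)))
    · exact Or.inl (Or.inl (Or.inr h))
    · exact Or.inl (Or.inr h)
    · exact Or.inr h
  refine (measureReal_mono hcover (measure_ne_top _ _)).trans ?_
  refine (measureReal_biUnion_finset_le _ _).trans ?_
  have h01 : (0 : ℤ) ≠ -1 := by decide
  rw [Finset.sum_insert (by simp [h01]), Finset.sum_singleton]
  have six : ∀ t : ℤ, (t = 0 ∨ t = -1) →
      (P).real (Wev⟪(∅ : Finset (Site 2 × Fin 2)), (pt⟪0, 2 * t + 1⟫, d)⟫ ∪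
          Wev⟪({(pt⟪0, 2 * t + 1⟫, d)} : Finset (Site 2 × Fin 2)), (pt⟪1, t⟫, d')⟫ ∪
          Wev⟪(∅ : Finset (Site 2 × Fin 2)), (pt⟪-1, t⟫, d')⟫ ∪
          Wev⟪({(pt⟪-1, t⟫, d')} : Finset (Site 2 × Fin 2)), (pt⟪-1, 2 * t + 1⟫, d)⟫ ∪
          Wev⟪({(pt⟪-1, t⟫, d'), (pt⟪-1, 2 * t + 1⟫, d)} : Finset (Site 2 × Fin 2)), (pt⟪0, 2 * t + 1⟫, d)⟫ ∪
          Wev⟪({(pt⟪-1, t⟫, d'), (pt⟪-1, 2 * t + 1⟫, d), (pt⟪0, 2 * t + 1⟫, d)} : Finset (Site 2 × Fin 2)),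
            (pt⟪1, t⟫, d')⟫) ≤ 6 * (8000 * PS) := by
    intro t ht
    obtain ⟨b1, b2, b3, b4, b5, b6⟩ := bound t ht
    set E1 := Wev⟪(∅ : Finset (Site 2 × Fin 2)), (pt⟪0, 2 * t + 1⟫, d)⟫ with hE1
    set E2 := Wev⟪({(pt⟪0, 2 * t + 1⟫, d)} : Finset (Site 2 × Fin 2)), (pt⟪1, t⟫, d')⟫ with hE2
    set E3 := Wev⟪(∅ : Finset (Site 2 × Fin 2)), (pt⟪-1, t⟫, d')⟫ with hE3
    set E4 := Wev⟪({(pt⟪-1, t⟫, d')} : Finset (Site 2 × Fin 2)), (pt⟪-1, 2 * t + 1⟫, d)⟫ with hE4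
    set E5 := Wev⟪({(pt⟪-1, t⟫, d'), (pt⟪-1, 2 * t + 1⟫, d)} : Finset (Site 2 × Fin 2)), (pt⟪0, 2 * t + 1⟫, d)⟫
      with hE5
    set E6 := Wev⟪({(pt⟪-1, t⟫, d'), (pt⟪-1, 2 * t + 1⟫, d), (pt⟪0, 2 * t + 1⟫, d)} : Finset (Site 2 × Fin 2)),
      (pt⟪1, t⟫, d')⟫ with hE6
    have u1 := measureReal_union_le (μ := P) (E1 ∪ E2 ∪ E3 ∪ E4 ∪ E5) E6
    have u2 := measureReal_union_le (μ := P) (E1 ∪ E2 ∪ E3 ∪ E4) E5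
    have u3 := measureReal_union_le (μ := P) (E1 ∪ E2 ∪ E3) E4
    have u4 := measureReal_union_le (μ := P) (E1 ∪ E2) E3
    have u5 := measureReal_union_le (μ := P) E1 E2
    linarith
  have s0 := six 0 (Or.inl rfl)
  have s1 := six (-1) (Or.inr rfl)
  linarith

end Cone3

/-- **Registered sub-goal `stub_cone3_largeA` of stub `stub_cone3`** (`Cone3.real_walkEvent_le` with all local notations
expanded). -/
theorem stub_cone3_largeA : ∀ {n : ℕ} {ρ c : ℝ} {b : Site 2} {d d' : Fin 2} (hd : d' ≠ d) (hρ0 : 0 ≤ ρ) (hρ1 : ρ ≤ 1) (hc : 1 / 10 ≤ c) (hc1 : c ≤ 1) {O : Finset (Site 2 × Fin 2)} (hO : ∀ ℓ ∈ O, ¬ IsAxialEdge 3 ℓ) (hO3 : O.card ≤ 3) {g : Site 2 × Fin 2} (hgO : g ∉ O), (((prodBernoulli (refinementParam 3 ρ c)))).real ((({S : Set (Site 2 × Fin 2 × Fin 3) | edgeConfig ((({e : Site 2 × Fin 2 | RefinementOpen 3 (S) e}) \ ({(g)} ∪ (({((((3 : ℤ) • b + ((0) : ℤ) • (Pi.single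 d (1 : ℤ) : Site 2) + ((0) : ℤ) • (Pi.single d' (1 : ℤ) : Site 2))), d), ((((3 : ℤ) • b + ((1) : ℤ) • (Pi.single d (1 : ℤ) : Site 2) + ((0) : ℤ) • (Pi.single d' (1 : ℤ) : Site 2))), d), ((((3 : ℤ) • b + ((2) : ℤ) • (Pi.single d (1 : ℤ) : Site 2) + ((0) : ℤ) • (Pi.single d' (1 : ℤ) : Site 2))), d)} : Set (Site 2 × Fin 2))))) ∪ ({(g)} ∪ ↑(O))) ∈ KST2023.crossing (3 * n) (3 * (3 * n))}) \ ({S : Set (Site 2 × Fin 2 × Fin 3) | edgeConfig ((({e : Site 2 × Fin 2 | RefinementOpen 3 (S) e}) \ ({(g)} ∪ (({((((3 : ℤ) • b + ((0) : ℤ) • (Pi.single d (1 : ℤ) : Site 2) + ((0) : ℤ) • (Pi.single d' (1 : ℤ) : Site 2))), d), ((((3 : ℤ) • b + ((1) : ℤ) • (Pi.single d (1 : ℤ) : Site 2) + ((0) : ℤ) • (Pi.single d' (1 : ℤ) : Site 2))), d), ((((3 : ℤ) • b + ((2) : ℤ) • (Pi.single d (1 : ℤ) : Site 2) + ((0) :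 ℤ) • (Pi.single d' (1 : ℤ) : Site 2))), d)} : Set (Site 2 × Fin 2))))) ∪ (∅ ∪ ↑(O))) ∈ KST2023.crossing (3 * n) (3 * (3 * n))}))) ≤ 8000 * (((prodBernoulli (refinementParam 3 ρ c)))).real (({S : Set (Site 2 × Fin 2 × Fin 3) | edgeConfig ((({e : Site 2 × Fin 2 | RefinementOpen 3 (S) e}) \ {(g)}) ∪ {(g)}) ∈ KST2023.crossing (3 * n) (3 * (3 * n))} \ {S : Set (Site 2 × Fin 2 × Fin 3) | edgeConfig ((({e : Site 2 × Fin 2 | RefinementOpen 3 (S) e}) \ {(g)}) ∪ ∅) ∈ KST2023.crossing (3 * n) (3 * (3 * n))})) := by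
  intro n ρ c b d d' hd hρ0 hρ1 hc hc1 O hO hO3 g hgO
  exact Cone3.real_walkEvent_le hd hρ0 hρ1 hc hc1 hO hO3 hgO

end Summit.CriticalPhenomena.CardyFormulaZ2.Cruxes.CriticalPathRSW.FiniteSizeEnvelope

end
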